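import Summits.HubbardSuperconductivity.HubbardSuperconductivity.Theorems.BalabanIRBirGappedPhaseReductionThermal
import Literature.MathematicalPhysics.QuantumLattice.FinDimSpectrumSectorGibbsLimit
import Literature.MathematicalPhysics.QuantumLattice.PairChirality

/-!
# Route `BalabanIR`, crux `BirGroundStateAverageLRO` (item `stmt-HubbardSuperconductivity-2079`), line `Sketch` (softmin-pair-penalty): stub `stub_sectorProjCommutePair`

"The pair penalty is block diagonal in the particle-number sectors." On the `L × L` Hubbard torus,
the d-wave pair penalty `A = Δ_d† Δ_d` (`Δ_d = pairField dWaveFormFactor L`) commutes with the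
orthogonal projection `P_S` onto the joint sector `S = szSector (2m) 0` (`N = 2m` electrons,
`S^z = 0`, i.e. `(N↑, N↓) = (m, m)`):

  `P_S A = A P_S`.

Proof (folklore): `Δ_d = Σ_x P_d(x)` and each local pair `P_d(x)` removes one up and one down
electron, so it has `(N↑, N↓)`-grade `(-1, -1)` (`PairChirality.shifts_localPair`,
`PairChirality.Shifts.sum`); hence `Δ_d†` has grade `(1, 1)` and `A = Δ_d† Δ_d` has grade `(0, 0)`,
i.e. `A` preserves the `(N↑, N↓)` sectors (`PairChirality.Shifts.conjTranspose`, `.mul`,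
`.preservesSectors`), in particular it leaves `S` invariant (`mem_szSector_two_mul_zero_iff`,
`PreservesSectors.isInSector_mulVec`). A Hermitian matrix (`A = Δ_d† Δ_d`,
`Matrix.isHermitian_conjTranspose_mul_self`) leaving a subspace invariant commutes with the
orthogonal projection onto it (`projMatrix_map_commute_of_invariant`). Used in
`everyGroundState_of_floorAt` of the line skeleton
`Cruxes/BirGroundStateAverageLRO/Lines/Sketch.lean` (all the convexity lemmas of the softmin lever
need `P_S` to commute with both `H` and the penalty `A`).

Sources: E. H. Lieb, *Two theorems on the Hubbard model*, PRL 62 (1989) 1201 (the `(N↑, N↓)`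
sectors of the Hubbard Hamiltonian); H. Tasaki, *Physics and Mathematics of Quantum Many-Body
Systems* (2020), §9.3. Folklore; no definition is introduced.
-/

noncomputable section

namespace Summit.HubbardSuperconductivity.HubbardSuperconductivity.Theorems.BirGroundStateAverageLRO.Softmin

open Matrix Finset Literature.MathematicalPhysics.QuantumLattice Literature.Probability.LatticeModels
open scoped ComplexOrder

/-- The d-wave pair field `Δ_d = Σ_x P_d(x)` removes one up and one down electron: it has
`(N↑, N↓)`-grade `(-1, -1)` (`PairChirality.shifts_localPair`, summed over `x`). [folklore] -/
theorem shifts_pairField_dWave (L : ℕ) [NeZero L] :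
    PairChirality.Shifts (-1) (-1) (pairField dWaveFormFactor L) :=
  PairChirality.Shifts.sum fun x _ => PairChirality.shifts_localPair L dWaveFormFactor x

/-- The d-wave pair penalty `Δ_d† Δ_d` has `(N↑, N↓)`-grade `(0, 0)`: it preserves the
`(N↑, N↓)` sectors. Lieb, PRL 62 (1989) 1201. [folklore] -/
theorem preservesSectors_pairField_dWave_conjTranspose_mul_self (L : ℕ) [NeZero L] :
    PreservesSectors ((pairField dWaveFormFactor L)ᴴ * pairField dWaveFormFactor L) := by
  have hS := shifts_pairField_dWave L
  have hP := (hS.conjTranspose).mul hS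
  norm_num at hP
  exact hP.preservesSectors

/-- The joint sector `(N, S^z) = (2m, 0)` of the torus is invariant under the d-wave pair penalty
`Δ_d† Δ_d` (it preserves the `(N↑, N↓) = (m, m)` sector). [folklore] -/
theorem pairPenalty_mulVec_mem_szSector (L : ℕ) [NeZero L] (m : ℕ)
    {ψ : Fock (Orb (FermionTorus 2 L))} (hψ : ψ ∈ szSector (Λ := FermionTorus 2 L) (2 * m) 0) :
    ((pairField dWaveFormFactor L)ᴴ * pairField dWaveFormFactor L) *ᵥ ψ ∈
      szSector (Λ := FermionTorus 2 L) (2 * m) 0 := by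
  rw [mem_szSector_two_mul_zero_iff] at hψ ⊢
  exact (preservesSectors_pairField_dWave_conjTranspose_mul_self L).isInSector_mulVec hψ

/-- **The sector projection commutes with the pair penalty.** The orthogonal projection onto the
joint sector `(N, S^z) = (2m, 0)` of the `L × L` Hubbard torus commutes with `Δ_d† Δ_d`
(`Δ_d` has `(N↑, N↓)`-grade `(-1,-1)`, so the Hermitian `Δ_d† Δ_d` preserves the `(N↑, N↓)`
sectors, hence leaves the sector invariant; `projMatrix_map_commute_of_invariant`).
Lieb, PRL 62 (1989) 1201. [folklore] -/
theorem stub_sectorProjCommutePair (L : ℕ) [NeZero L] (m : ℕ) :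
    Commute (projMatrix ((szSector (Λ := FermionTorus 2 L) (2 * m) 0).map
        (Fock.toEuclidean (ι := Orb (FermionTorus 2 L)) :
          Fock (Orb (FermionTorus 2 L)) →ₗ[ℂ]
            EuclideanSpace ℂ (Finset (Orb (FermionTorus 2 L))))))
      ((pairField dWaveFormFactor L)ᴴ * pairField dWaveFormFactor L) :=
  projMatrix_map_commute_of_invariant (Matrix.isHermitian_conjTranspose_mul_self _)
    (szSector (Λ := FermionTorus 2 L) (2 * m) 0)
    fun _ hv => pairPenalty_mulVec_mem_szSector L m hv

end Summit.HubbardSuperconductivity.HubbardSuperconductivity.Theorems.BirGroundStateAverageLRO.Softmin
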